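import Literature.Geometry.Lorentzian.BondiBartnikGap
import Literature.Geometry.Lorentzian.NearKerrCollarCore
import Literature.Geometry.Lorentzian.SoundNearKerrLeaf
import Literature.Geometry.Lorentzian.KillingHorizonShadowAlong
import Literature.Geometry.Lorentzian.CausalFutureProofs
import Literature.Geometry.Lorentzian.DeviationTolerance
import Summits.FinalStateConjecture.FinalStateConjecture.Theorems.BartnikGapSettlingBondiBartnikRigidityDirectMethodDefs
import HarnessLib

/-!
# Work file — stub stub_farCompletion of line `direct-method-on-the-cone` (crux BondiBartnikRigidity,
# stmt-FinalStateConjecture-10807), lead a2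

LANDING FORM (applied: p130340 ACCEPTED 2026-08-16): the line's vocabulary is imported from
`Theorems/BartnikGapSettlingBondiBartnikRigidityDirectMethodDefs.lean`; the namespace is the Defs
namespace, so the registered signature elaborates unchanged.  STATUS: the registered stub keeps its
`sorry` (verdict `stub-blocked`, see `work/stubs/stub_farCompletion.report.md`); everything else in
this file is sorry-free bookkeeping (recentring, box ⟹ near-zone layer, assembly of a sound leaf from a
box and a far chart, reduction of the stub to the far chart).
Target: `Summits/FinalStateConjecture/FinalStateConjecture/Theorems/BartnikGapSettlingBondiBartnikRigidityFarCompletion.lean`.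
-/

noncomputable section

set_option linter.dupNamespace false

open Set Filter Function Topology TopologicalSpace
open Literature.Geometry.Lorentzian
open scoped Manifold ContDiff Topology ENNReal

namespace Summit.FinalStateConjecture.FinalStateConjecture.Theorems.BondiBartnikRigidity.DirectMethod


/-! ## K4 bookkeeping for `stub_farCompletion` (all proved; no new facts)

Four groups of lemmas, used by the assembly theorem `isSoundNearKerrLeaf_of_box_of_farChart`
and recorded for the lead (see `work/stubs/stub_farCompletion.report.md`):

* **empty boxes** — `coordBox_eq_empty_of_le`, `isNearModelBox_of_coordBox_eq_empty`: a box with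
  `r₂ ≤ r₁` or `τ₂ ≤ τ₁` is empty and then `IsNearModelBox` holds for EVERY chart, so a bad choice of
  `(R, T)` makes the box hypothesis of K4 trivially TRUE (no vacuity escape), never contradictory;
* **causal bookkeeping** — `J⁺(J⁺ A) = J⁺ A` on a development, `J⁺(C) ⊆ J⁺(ι X)` for the core of a
  leaf through `p`, and "a set inside `J⁺` of the image of a box inside `J⁺(C)` is inside `J⁺(C)`";
* **recentring in time** (`shiftTime`, `recentre`, `shiftTime_starBackground`): the
  star background with its Kerr-star time shifted by `s` IS the star background of the time-translated
  motion `(Λ, c + Λ (s e₀))` (stationarity of the Kerr–Schild form, `t*`-invariance of the Kerr–Schild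
  radius and of the star region), and the metric deviation of a chart is unchanged by the shift;
* **box ⟹ near-zone layer** (`nearLayer_shiftTime_subset_coordBox`, `IsNearModelBox.*_of_subset`): inside an `(ε₁, k₁)`-box of length `≥ 2`
  every recentred near-zone LAYER `{−1 < t* − s < 1, r < R₁ + 1}`, `R₁ + 1 ≤ r₂`, inherits smoothness,
  the open-embedding property, the image clause and the LAYER certification — the hole-chart half of a
  sound leaf (clauses (9), (13), (S₂) of `IsSoundNearKerrLeaf`);
* **assembly and reduction** — `isSoundNearKerrLeaf_of_box_of_farChart` (a box + a far chart with the
  listed clauses ⟹ a SOUND `(ε, k)`-leaf with the hole `(M, a)` inside `J⁺(C)`; all 25 clauses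
  discharged) and `stub_farCompletion_of_farChart` (the registered stub from the existence of the far
  chart relative to the box — the report's Fact F2, NOT available, and shown there to be false as a
  uniform lemma in the collar's frame: the K4 statement survives only through Fact F∞).
-/

section FarCompletionBookkeeping

universe u

/-! ### Empty boxes: the box hypothesis is never contradictory -/

/-- A coordinate box with `r₂ ≤ r₁` or `τ₂ ≤ τ₁` is empty. [folklore] -/
theorem coordBox_eq_empty_of_le (B : ModelBackground) {τ₁ τ₂ r₁ r₂ : ℝ}
    (h : r₂ ≤ r₁ ∨ τ₂ ≤ τ₁) : coordBox B τ₁ τ₂ r₁ r₂ = ∅ := by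
  ext x
  simp only [mem_coordBox, mem_empty_iff_false, iff_false, not_and, not_lt]
  intro h₁ h₂ h₃
  rcases h with h | h
  · exact h.trans h₃.le
  · exact absurd (h₁.trans (h₂.trans_le h)) (lt_irrefl _)

/-- Over an EMPTY coordinate box `IsNearModelBox` holds for every chart map and every `(k, ε, J)`:
smoothness and the image clause are vacuous, the restriction to the empty subtype is an open
embedding, and the `Cᵏ` sup norm over `∅` is `0`.  So choosing `R + 1 ≤ M` or `T ≤ 0` in K4 makes its
box hypothesis trivially satisfiable — true, not false: no vacuity escape. [folklore] -/
theorem isNearModelBox_of_coordBox_eq_empty {𝒮 : Spacetime.{u} 4} {B : ModelBackground} {k : ℕ}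
    {ε : ℝ≥0∞} {τ₁ τ₂ r₁ r₂ : ℝ} {J : Set 𝒮.carrier} (h : coordBox B τ₁ τ₂ r₁ r₂ = ∅)
    (Ψ : B.domain → 𝒮.carrier) : IsNearModelBox 𝒮 B k ε τ₁ τ₂ r₁ r₂ J Ψ := by
  haveI : IsEmpty (coordBox B τ₁ τ₂ r₁ r₂) := by
    rw [h]
    exact Set.isEmpty_coe_sort.mpr rfl
  refine ⟨?_, IsOpenEmbedding.of_isEmpty _, ?_, ?_⟩
  · rw [h]
    exact contMDiffOn_of_locally_contMDiffOn fun x hx ↦ hx.elim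
  · rw [h, image_empty]
    exact empty_subset _
  · rw [h, image_empty]
    simp [supCkENorm]

/-! ### Causal bookkeeping on a Cauchy development -/

section Causal

variable {X : Type u} [TopologicalSpace X] [ChartedSpace E3 X] [IsManifold (𝓡 3) ∞ X]
  [ConnectedSpace X] {D : InitialDataSet (𝓡 3) X}

/-- `J⁺(J⁺(A)) = J⁺(A)` in a vacuum Cauchy development (boundaryless `C^∞` carrier;
`LorentzianMetric.causalFuture_causalFuture_eq`). O'Neill 1983, Ch. 14, p. 402.
[cite: ONeillSemiRiemannian1983, Ch. 14, p. 402] -/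
theorem causalFuture_causalFuture (𝒟 : VacuumCauchyDevelopment D) (A : Set 𝒟.carrier) :
    𝒟.metric.causalFuture 𝒟.timeOrientation (𝒟.metric.causalFuture 𝒟.timeOrientation A) =
      𝒟.metric.causalFuture 𝒟.timeOrientation A :=
  LorentzianMetric.causalFuture_causalFuture_eq
    (WithTop.coe_le_coe.mpr le_top : (2 : ℕ∞ω) ≤ ((⊤ : ℕ∞) : ℕ∞ω)) A

/-- A set inside `J⁺(A')` with `A' ⊆ J⁺(A)` is inside `J⁺(A)` (monotonicity and idempotence of
`J⁺`). O'Neill 1983, Ch. 14, p. 402. [cite: ONeillSemiRiemannian1983, Ch. 14, p. 402] -/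
theorem subset_causalFuture_of_subset (𝒟 : VacuumCauchyDevelopment D) {A A' S' : Set 𝒟.carrier}
    (hA' : A' ⊆ 𝒟.metric.causalFuture 𝒟.timeOrientation A)
    (hS' : S' ⊆ 𝒟.metric.causalFuture 𝒟.timeOrientation A') :
    S' ⊆ 𝒟.metric.causalFuture 𝒟.timeOrientation A :=
  (hS'.trans (LorentzianMetric.causalFuture_mono hA')).trans (causalFuture_causalFuture 𝒟 A).le

/-- The core of a thick collar carried by a typed leaf through `p` lies to the causal future of the
data hypersurface, hence so does its causal future: `J⁺(C) ⊆ J⁺(ι X)` (`C ⊆ S ⊆ J⁺(ι X)` by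
`IsNearKerrLeaf.subset_causalFuture`, then idempotence).
[cite: ONeillSemiRiemannian1983, Ch. 14, p. 402] -/
theorem causalFuture_collarCore_subset {𝒟 : VacuumCauchyDevelopment D} {k : ℕ} {ε : ℝ≥0∞} {N N' : ℕ}
    {M' a' : Fin N' → ℝ} {S : Set 𝒟.carrier} {M : Fin N → ℝ} {p : 𝒟.carrier}
    {B : Fin N → ModelBackground} {Φ : ∀ i, (B i).domain → 𝒟.carrier}
    (hleaf : 𝒟.toCauchyDevelopment.IsNearKerrLeaf k ε N' M' a' S) (hp : p ∈ S)
    (hΦ : ∀ i, Φ i '' (B i).truncTimeSlab (3 * M i) 0 ⊆ S) :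
    𝒟.metric.causalFuture 𝒟.timeOrientation (collarCore M p B Φ) ⊆
      𝒟.metric.causalFuture 𝒟.timeOrientation (range 𝒟.embed) :=
  (LorentzianMetric.causalFuture_mono
    ((collarCore_subset M p B Φ hp hΦ).trans hleaf.subset_causalFuture)).trans
    (causalFuture_causalFuture 𝒟 _).le

/-- **Box version.** If `Ψ` is an `(ε, k)`-box inside `J⁺(C)` then every set inside the causal future
of the box image is inside `J⁺(C)` — the form in which a sound leaf built to the future of the box's
late slab inherits `S' ⊆ J⁺(C)`. [cite: ONeillSemiRiemannian1983, Ch. 14, p. 402] -/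
theorem subset_causalFuture_of_isNearModelBox (𝒟 : VacuumCauchyDevelopment D) {B : ModelBackground}
    {k : ℕ} {ε : ℝ≥0∞} {τ₁ τ₂ r₁ r₂ : ℝ} {C S' : Set 𝒟.carrier} {Ψ : B.domain → 𝒟.carrier}
    (hbox : IsNearModelBox 𝒟.toSpacetime B k ε τ₁ τ₂ r₁ r₂
      (𝒟.metric.causalFuture 𝒟.timeOrientation C) Ψ)
    (hS' : S' ⊆ 𝒟.metric.causalFuture 𝒟.timeOrientation (Ψ '' coordBox B τ₁ τ₂ r₁ r₂)) :
    S' ⊆ 𝒟.metric.causalFuture 𝒟.timeOrientation C :=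
  subset_causalFuture_of_subset 𝒟 hbox.image_subset hS'

end Causal

/-! ### Recentring a star background in Kerr-star time -/

/-- The background `B` with its time function shifted by `s` (`t ↦ t − s`); domain, reference form
and radius unchanged (definitionally). [folklore] -/
abbrev shiftTime (B : ModelBackground) (s : ℝ) : ModelBackground :=
  ⟨B.domain, B.bilin, fun x => B.time x - s, B.radius⟩

@[simp] theorem shiftTime_domain (B : ModelBackground) (s : ℝ) : (shiftTime B s).domain = B.domain :=
  rfl

@[simp] theorem shiftTime_bilin (B : ModelBackground) (s : ℝ) : (shiftTime B s).bilin = B.bilin := rfl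

@[simp] theorem shiftTime_time (B : ModelBackground) (s : ℝ) (x : E4) :
    (shiftTime B s).time x = B.time x - s := rfl

@[simp] theorem shiftTime_radius (B : ModelBackground) (s : ℝ) : (shiftTime B s).radius = B.radius :=
  rfl

/-- The metric deviation of a chart is unchanged by shifting the background's time function (it
involves only the domain and the reference form). [folklore] -/
theorem deviationExtend_shiftTime (𝒮 : Spacetime.{u} 4) (B : ModelBackground) (s : ℝ)
    (Ψ : B.domain → 𝒮.carrier) :
    𝒮.deviationExtend (shiftTime B s) Ψ = 𝒮.deviationExtend B Ψ :=
  rfl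

/-- The motion `(Λ, c)` translated by `s` units of its own rest-frame time: `(Λ, c + Λ (s e₀))`.
[folklore] -/
def recentre (mo : lorentzGroup × E4) (s : ℝ) : lorentzGroup × E4 :=
  (mo.1, mo.2 + (mo.1 : E4 ≃L[ℝ] E4) (s • E4.basisVector 0))

@[simp] theorem recentre_fst (mo : lorentzGroup × E4) (s : ℝ) : (recentre mo s).1 = mo.1 := rfl

/-- Rest-frame coordinates of the recentred motion are the old ones translated by `−s e₀`:
`Λ⁻¹(x − c − Λ(s e₀)) = Λ⁻¹(x − c) − s e₀`. [folklore] -/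
theorem poincareInv_recentre (mo : lorentzGroup × E4) (s : ℝ) (x : E4) :
    poincareInv (recentre mo s).1 (recentre mo s).2 x =
      poincareInv mo.1 mo.2 x + (-s) • E4.basisVector 0 := by
  show (mo.1 : E4 ≃L[ℝ] E4).symm (x - (mo.2 + (mo.1 : E4 ≃L[ℝ] E4) (s • E4.basisVector 0))) =
    (mo.1 : E4 ≃L[ℝ] E4).symm (x - mo.2) + (-s) • E4.basisVector 0
  rw [← sub_sub, map_sub, ContinuousLinearEquiv.symm_apply_apply, neg_smul, sub_eq_add_neg]

/-- **Recentring lemma.** Shifting the Kerr-star time of the boosted Kerr STAR background (with the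
boosted Kerr–Schild radius) by `s` gives exactly the star background of the recentred motion: the
star region and the Kerr–Schild radius are `t*`-translation invariant
(`Kerr.radius_add_time_smul_basisVector`) and the Kerr–Schild form is stationary
(`Kerr.bilin_add_smul_basisVector_zero`). Kerr–Schild 1965, §2; DR arXiv:0811.0354, §5.1.
[cite: KerrSchild1965, §2] -/
theorem shiftTime_starBackground (mo : lorentzGroup × E4) (M a s : ℝ) :
    shiftTime (starBackground mo.1 mo.2 M a (fun x => Kerr.radius a (poincareInv mo.1 mo.2 x))) s =
      starBackground (recentre mo s).1 (recentre mo s).2 M a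
        (fun x => Kerr.radius a (poincareInv (recentre mo s).1 (recentre mo s).2 x)) := by
  have hrad : (fun x => Kerr.radius a (poincareInv (recentre mo s).1 (recentre mo s).2 x)) =
      fun x => Kerr.radius a (poincareInv mo.1 mo.2 x) := by
    funext x
    rw [poincareInv_recentre, Kerr.radius_add_time_smul_basisVector]
  have hdom : (starBackground (recentre mo s).1 (recentre mo s).2 M a
        (fun x => Kerr.radius a (poincareInv (recentre mo s).1 (recentre mo s).2 x))).domain =
      (starBackground mo.1 mo.2 M a (fun x => Kerr.radius a (poincareInv mo.1 mo.2 x))).domain := by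
    ext x
    simp only [coe_starBackground_domain, mem_preimage, SetLike.mem_coe, Kerr.mem_region,
      poincareInv_recentre, Kerr.radius_add_time_smul_basisVector]
  have hbil : boostedKerrBilin (recentre mo s).1 (recentre mo s).2 M a =
      boostedKerrBilin mo.1 mo.2 M a := by
    funext x
    ext v w
    rw [boostedKerrBilin_apply, boostedKerrBilin_apply, poincareInv_recentre,
      Kerr.bilin_add_smul_basisVector_zero, recentre_fst]
  unfold shiftTime
  conv_rhs => unfold starBackground
  rw [starBackground_bilin, starBackground_radius]
  congr 1
  · exact hdom.symm
  · exact hbil.symm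
  · funext x
    rw [starBackground_time, poincareInv_recentre]
    simp [sub_eq_add_neg]
  · exact hrad.symm

/-! ### Star backgrounds: inner radius and continuity of the coordinate functions -/

section Star

variable {B : ModelBackground} {Λ : lorentzGroup} {c : E4} {M a : ℝ}

/-- On the boosted star background the Kerr–Schild radius exceeds the inner radius `M`
(the domain is `{max M 0 < r}`; DR arXiv:0811.0354, §5.1). [cite: DafermosRodnianski2008, §5.1] -/
theorem lt_radius_of_eq_starBackground
    (hB : B = starBackground Λ c M a fun x => Kerr.radius a (poincareInv Λ c x)) (x : B.domain) :
    M < B.radius x.1 := by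
  subst hB
  exact Kerr.lt_radius_of_mem_region x.2

/-- The Kerr-star time of a boosted star background is continuous. [folklore] -/
theorem continuous_time_of_eq_starBackground
    (hB : B = starBackground Λ c M a fun x => Kerr.radius a (poincareInv Λ c x)) :
    Continuous B.time := by
  subst hB
  exact (EuclideanSpace.proj (0 : Fin 4)).continuous.comp (continuous_poincareInv Λ c)

/-- The Kerr–Schild radius of a boosted star background is continuous. [folklore] -/
theorem continuous_radius_of_eq_starBackground
    (hB : B = starBackground Λ c M a fun x => Kerr.radius a (poincareInv Λ c x)) :
    Continuous B.radius := by
  subst hB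
  exact (Kerr.continuous_radius a).comp (continuous_poincareInv Λ c)

end Star

/-! ### From a box to the near-zone layer of the recentred background -/

/-- The NEAR-ZONE LAYER `{−1 < t < 1, r < R₁ + 1}` of a background (the set `Lᵢ` of
`IsSoundNearKerrLeaf`). [cite: DafermosHolzegelRodnianskiTaylor2021, §1] -/
def nearLayer (B : ModelBackground) (R₁ : ℝ) : Set B.domain :=
  {x | -1 < B.time x.1 ∧ B.time x.1 < 1 ∧ B.radius x.1 < R₁ + 1}

/-- The UPPER near-zone layer `{0 < t < 1, r ≤ R₁}` (the set `Wᵢ` of `IsSoundNearKerrLeaf`).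
[cite: DafermosHolzegelRodnianskiTaylor2021, §1] -/
def nearUpper (B : ModelBackground) (R₁ : ℝ) : Set B.domain :=
  {x | 0 < B.time x.1 ∧ B.time x.1 < 1 ∧ B.radius x.1 ≤ R₁}

/-- The hole-side OVERLAP ANNULUS `{t = 0, ρ < r ≤ R₁}`. [cite: DafermosHolzegelRodnianskiTaylor2021, §1] -/
def nearAnnulus (B : ModelBackground) (ρ R₁ : ℝ) : Set B.domain :=
  {x | B.time x.1 = 0 ∧ ρ < B.radius x.1 ∧ B.radius x.1 ≤ R₁}

/-- The flat LAYER `{−1 < t₀ < 1}` of the hyperboloidal background on `U₀` (the set `L₀`).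
[cite: DafermosHolzegelRodnianskiTaylor2021, §1] -/
def flatLayer (U₀ : Opens E4) : Set (hypBackground U₀).domain :=
  {x | -1 < (hypBackground U₀).time x.1 ∧ (hypBackground U₀).time x.1 < 1}

/-- The upper flat layer `{0 < t₀ < 1}` (the set `W₀`). [cite: DafermosHolzegelRodnianskiTaylor2021, §1] -/
def flatUpper (U₀ : Opens E4) : Set (hypBackground U₀).domain :=
  {x | 0 < (hypBackground U₀).time x.1 ∧ (hypBackground U₀).time x.1 < 1}

/-- The flat-side OVERLAP ANNULUS `{t₀ = 0, ρ < r(x) < R₁}` for a radius function `r` on `E4`.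
[cite: DafermosHolzegelRodnianskiTaylor2021, §1] -/
def flatAnnulus (U₀ : Opens E4) (r : E4 → ℝ) (ρ R₁ : ℝ) : Set (hypBackground U₀).domain :=
  {x | (hypBackground U₀).time x.1 = 0 ∧ ρ < r x.1 ∧ r x.1 < R₁}

section BoxToLayer

variable {𝒮 : Spacetime.{u} 4} {B : ModelBackground} {k : ℕ} {ε : ℝ≥0∞} {τ₁ τ₂ r₁ r₂ s R₁ : ℝ}
  {J : Set 𝒮.carrier} {Ψ : B.domain → 𝒮.carrier}

/-- A recentred near-zone layer of truncation radius `R₁` lies in the box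
`{τ₁ < t < τ₂, r₁ < r < r₂}` as soon as `τ₁ ≤ s − 1`, `s + 1 ≤ τ₂`, `R₁ + 1 ≤ r₂` and `r > r₁` on the
whole domain (for the star background: `r > M`). [folklore] -/
theorem nearLayer_shiftTime_subset_coordBox (hs₁ : τ₁ ≤ s - 1) (hs₂ : s + 1 ≤ τ₂)
    (hR₁ : R₁ + 1 ≤ r₂) (hdom : ∀ x : B.domain, r₁ < B.radius x.1) :
    nearLayer (shiftTime B s) R₁ ⊆ coordBox B τ₁ τ₂ r₁ r₂ := by
  intro x hx
  simp only [nearLayer, mem_setOf_eq] at hx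
  exact ⟨by linarith [hx.1], by linarith [hx.2.1], hdom x, hx.2.2.trans_le hR₁⟩

/-- The recentred slab `{t = s, r ≤ R₁}` lies in the box. [folklore] -/
theorem truncTimeSlab_shiftTime_subset_coordBox (hs₁ : τ₁ < s) (hs₂ : s < τ₂) (hR₁ : R₁ < r₂)
    (hdom : ∀ x : B.domain, r₁ < B.radius x.1) :
    (shiftTime B s).truncTimeSlab R₁ 0 ⊆ coordBox B τ₁ τ₂ r₁ r₂ := by
  intro x hx
  rw [ModelBackground.mem_truncTimeSlab, shiftTime_time, shiftTime_radius, sub_eq_zero] at hx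
  exact ⟨hx.1 ▸ hs₁, hx.1 ▸ hs₂, hdom x, hx.2.trans_lt hR₁⟩

/-- The recentred slab lies in the truncated near-zone layer `{x ∈ L | r ≤ R₁}`. [folklore] -/
theorem truncTimeSlab_subset_nearLayer (B : ModelBackground) (R₁ : ℝ) :
    B.truncTimeSlab R₁ 0 ⊆ {x | x ∈ nearLayer B R₁ ∧ B.radius x.1 ≤ R₁} := by
  intro x hx
  rw [ModelBackground.mem_truncTimeSlab] at hx
  exact ⟨⟨by rw [hx.1]; norm_num, by rw [hx.1]; norm_num, by linarith [hx.2]⟩, hx.2⟩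

/-- The upper near-zone layer lies in the truncated near-zone layer. [folklore] -/
theorem nearUpper_subset_nearLayer (B : ModelBackground) (R₁ : ℝ) :
    nearUpper B R₁ ⊆ {x | x ∈ nearLayer B R₁ ∧ B.radius x.1 ≤ R₁} :=
  fun _ hx ↦ ⟨⟨by linarith [hx.1], hx.2.1, by linarith [hx.2.2]⟩, hx.2.2⟩

/-- The near-zone layer is open when the time and radius functions are continuous. [folklore] -/
theorem isOpen_nearLayer (hBt : Continuous B.time) (hBr : Continuous B.radius) (R₁ : ℝ) :
    IsOpen (nearLayer B R₁) := by
  have ht : Continuous fun x : B.domain => B.time x.1 := hBt.comp continuous_subtype_val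
  have hr : Continuous fun x : B.domain => B.radius x.1 := hBr.comp continuous_subtype_val
  exact (isOpen_lt continuous_const ht).inter
    ((isOpen_lt ht continuous_const).inter (isOpen_lt hr continuous_const))

/-- The near-zone layer of the time-shifted background is open (same hypotheses). [folklore] -/
theorem isOpen_nearLayer_shiftTime (hBt : Continuous B.time) (hBr : Continuous B.radius) (s R₁ : ℝ) :
    IsOpen (nearLayer (shiftTime B s) R₁) :=
  isOpen_nearLayer (B := shiftTime B s) (hBt.sub continuous_const) hBr R₁

namespace IsNearModelBox

variable (hbox : IsNearModelBox 𝒮 B k ε τ₁ τ₂ r₁ r₂ J Ψ)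
include hbox

/-- The chart of a box is smooth on every subset of the box. [folklore] -/
theorem contMDiffOn_of_subset {L : Set B.domain} (hL : L ⊆ coordBox B τ₁ τ₂ r₁ r₂) :
    ContMDiffOn 𝓘(ℝ, E4) (𝓡 4) ∞ Ψ L :=
  hbox.contMDiffOn.mono hL

/-- The chart of a box is an open embedding of every OPEN subset of the box (restriction of an open
embedding along the open inclusion). [folklore] -/
theorem isOpenEmbedding_of_subset {L : Set B.domain} (hL : L ⊆ coordBox B τ₁ τ₂ r₁ r₂)
    (hLo : IsOpen L) : IsOpenEmbedding (L.restrict Ψ) :=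
  hbox.isOpenEmbedding.comp (IsOpenEmbedding.inclusion hL (hLo.preimage continuous_subtype_val))

/-- The image of every subset of a box inside `J` lies in `J`. [folklore] -/
theorem image_subset_of_subset {L : Set B.domain} (hL : L ⊆ coordBox B τ₁ τ₂ r₁ r₂) :
    Ψ '' L ⊆ J :=
  (image_mono hL).trans hbox.image_subset

/-- The `Cᵏ` deviation over every subset of an `(ε, k)`-box is `≤ ε`. [folklore] -/
theorem supCkENorm_le_of_subset {A : Set B.domain} (hA : A ⊆ coordBox B τ₁ τ₂ r₁ r₂) :
    supCkENorm (Subtype.val '' A) k (𝒮.deviationExtend B Ψ) ≤ ε :=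
  (supCkENorm_mono (image_mono hA) _ _).trans hbox.supCkENorm_le

end IsNearModelBox

end BoxToLayer

/-! ### Assembly: a box and a far chart give a sound leaf inside `J⁺(C)` -/

section Assembly

variable {X : Type u} [TopologicalSpace X] [ChartedSpace E3 X] [IsManifold (𝓡 3) ∞ X]
  [ConnectedSpace X] {D : InitialDataSet (𝓡 3) X}

/-- **ASSEMBLY THEOREM (the bookkeeping half of K4, sorry-free).** In a vacuum Cauchy development let
`C` be a core whose causal future lies in `J⁺(ι X)`, let `B₁ = starBackground Λ c M a r` be a boosted
Kerr star background with `0 < M`, `|a| ≤ M`, and let `Ψ` be an `(ε₁, k₁)`-box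
`{τ < t* < τ + T, M < r < R + 1}` of `B₁` inside `J⁺(C)` with `k ≤ k₁`, `ε₁ ≤ ε`.  Suppose a FAR CHART is
given: a recentring time `s` with `[s − 1, s + 1] ⊆ [τ, τ + T]`, radii `0 < ρ < R₁`, `2M ≤ R₁ ≤ R`, an open
`U₀ ⊇ {t₀ > −1, r' > ρ}` (`r'` the Kerr–Schild radius of the recentred motion) and
`Ψ₀ : U₀ → 𝒟`, smooth and an open embedding on the flat layer `L₀ = {−1 < t₀ < 1}` with image in
`J⁺(ι X)`, `Cᵏ`-certified on the LAYER (`≤ ε`), charting the hole annulus `{t* = s, ρ < r ≤ R₁}` and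
charted by the hole layer on the flat annulus, with the upper layers in `I⁺(S')`, the barrier clause,
an ACHRONAL flat sheet, and the flat sheet inside `J⁺(C)`, where
`S' = Ψ₀{t₀ = 0} ∪ Ψ{t* = s, r ≤ R₁}`.  THEN `S'` is a SOUND `(ε, k)`-near-Kerr leaf with the single
hole `(M, a)` — hole chart the box's slab `{t* = s}` recentred to `{t*' = 0}` by
`shiftTime_starBackground`, layer-certified by the box — and `S' ⊆ J⁺(C)`.  Pure bookkeeping over
`CauchyDevelopment.IsSoundNearKerrLeaf`; the far chart itself is the missing analytic content
(report, Fact F2). [cite: DafermosHolzegelRodnianskiTaylor2021, §1] -/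
theorem isSoundNearKerrLeaf_of_box_of_farChart (𝒟 : VacuumCauchyDevelopment D) {k k₁ : ℕ}
    {ε ε₁ : ℝ≥0∞} {M a : Fin 1 → ℝ} {mo : Fin 1 → lorentzGroup × E4} {B : Fin 1 → ModelBackground}
    {C : Set 𝒟.carrier} {τ T R s R₁ ρ : ℝ} {Ψ : (B 0).domain → 𝒟.carrier} {U₀ : Opens E4}
    {Ψ₀ : (hypBackground U₀).domain → 𝒟.carrier}
    -- the hole labels and the background of the box
    (hM : 0 < M 0) (ha : |a 0| ≤ M 0)
    (hB : B 0 = starBackground (mo 0).1 (mo 0).2 (M 0) (a 0)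
      fun x => Kerr.radius (a 0) (poincareInv (mo 0).1 (mo 0).2 x))
    (hC : 𝒟.metric.causalFuture 𝒟.timeOrientation C ⊆
      𝒟.metric.causalFuture 𝒟.timeOrientation (range 𝒟.embed))
    -- the box
    (hbox : IsNearModelBox 𝒟.toSpacetime (B 0) k₁ ε₁ τ (τ + T) (M 0) (R + 1)
      (𝒟.metric.causalFuture 𝒟.timeOrientation C) Ψ)
    (hk : k ≤ k₁) (hε : ε₁ ≤ ε)
    -- the far chart: parameters
    (hs₁ : τ ≤ s - 1) (hs₂ : s + 1 ≤ τ + T) (hρ : 0 < ρ) (hρR : ρ < R₁) (h2M : 2 * M 0 ≤ R₁)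
    (hR₁ : R₁ ≤ R)
    (hU₀ : {x : E4 | -1 < x 0 - Real.sqrt (1 + E4.spatialNorm x ^ 2) ∧
      ρ < Kerr.radius (a 0) (poincareInv (recentre (mo 0) s).1 (recentre (mo 0) s).2 x)} ⊆
      (U₀ : Set E4))
    -- the far chart: flat clauses
    (hΨ₀ : ContMDiffOn 𝓘(ℝ, E4) (𝓡 4) ∞ Ψ₀ (flatLayer U₀))
    (hΨ₀e : IsOpenEmbedding ((flatLayer U₀).restrict Ψ₀))
    (hΨ₀J : Ψ₀ '' flatLayer U₀ ⊆ 𝒟.metric.causalFuture 𝒟.timeOrientation (range 𝒟.embed))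
    (hΨ₀layer : supCkENorm (Subtype.val '' flatLayer U₀) k
      (𝒟.toSpacetime.deviationExtend (hypBackground U₀) Ψ₀) ≤ ε)
    -- the far chart: overlaps with the recentred box chart
    (hover₁ : Ψ '' nearAnnulus (shiftTime (B 0) s) ρ R₁ ⊆ Ψ₀ '' flatLayer U₀)
    (hover₀ : Ψ₀ '' flatAnnulus U₀
        (fun x => Kerr.radius (a 0) (poincareInv (recentre (mo 0) s).1 (recentre (mo 0) s).2 x))
        ρ R₁ ⊆ Ψ '' nearLayer (shiftTime (B 0) s) R₁)
    -- the far chart: causal clauses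
    (hW : Ψ₀ '' flatUpper U₀ ∪ Ψ '' nearUpper (shiftTime (B 0) s) R₁ ⊆
      𝒟.metric.chronologicalFuture 𝒟.timeOrientation
        (Ψ₀ '' (hypBackground U₀).timeSlab 0 ∪ Ψ '' (shiftTime (B 0) s).truncTimeSlab R₁ 0))
    (hbar : 𝒟.toCauchyDevelopment.exteriorOf
        (Ψ₀ '' flatUpper U₀ ∪ Ψ '' nearUpper (shiftTime (B 0) s) R₁) \
        (Ψ₀ '' flatUpper U₀ ∪ Ψ '' nearUpper (shiftTime (B 0) s) R₁) ⊆
      𝒟.metric.causalPast 𝒟.timeOrientation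
        (Ψ₀ '' (hypBackground U₀).timeSlab 0 ∪ Ψ '' (shiftTime (B 0) s).truncTimeSlab R₁ 0))
    (hach : 𝒟.metric.IsAchronal 𝒟.timeOrientation (Ψ₀ '' (hypBackground U₀).timeSlab 0))
    (hsheet : Ψ₀ '' (hypBackground U₀).timeSlab 0 ⊆ 𝒟.metric.causalFuture 𝒟.timeOrientation C) :
    𝒟.toCauchyDevelopment.IsSoundNearKerrLeaf k ε 1 M a
        (Ψ₀ '' (hypBackground U₀).timeSlab 0 ∪ Ψ '' (shiftTime (B 0) s).truncTimeSlab R₁ 0) ∧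
      Ψ₀ '' (hypBackground U₀).timeSlab 0 ∪ Ψ '' (shiftTime (B 0) s).truncTimeSlab R₁ 0 ⊆
        𝒟.metric.causalFuture 𝒟.timeOrientation C := by
  -- the star background: inner radius and continuity
  have hdom : ∀ x : (B 0).domain, M 0 < (B 0).radius x.1 := lt_radius_of_eq_starBackground hB
  have hBt : Continuous (B 0).time := continuous_time_of_eq_starBackground hB
  have hBr : Continuous (B 0).radius := continuous_radius_of_eq_starBackground hB
  -- the recentred layer and slab sit in the box
  have hL : nearLayer (shiftTime (B 0) s) R₁ ⊆ coordBox (B 0) τ (τ + T) (M 0) (R + 1) :=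
    nearLayer_shiftTime_subset_coordBox hs₁ hs₂ (by linarith) hdom
  have hLo : IsOpen (nearLayer (shiftTime (B 0) s) R₁) := isOpen_nearLayer_shiftTime hBt hBr s R₁
  have hslab : (shiftTime (B 0) s).truncTimeSlab R₁ 0 ⊆ coordBox (B 0) τ (τ + T) (M 0) (R + 1) :=
    truncTimeSlab_shiftTime_subset_coordBox (by linarith) (by linarith) (by linarith) hdom
  have htrunc : {x | x ∈ nearLayer (shiftTime (B 0) s) R₁ ∧ (shiftTime (B 0) s).radius x.1 ≤ R₁} ⊆
      coordBox (B 0) τ (τ + T) (M 0) (R + 1) := fun x hx ↦ hL hx.1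
  -- the flat slab sits in the flat layer
  have hslab₀ : (hypBackground U₀).timeSlab 0 ⊆ flatLayer U₀ := by
    intro x hx
    rw [ModelBackground.mem_timeSlab] at hx
    simp only [flatLayer, mem_setOf_eq, hx]
    norm_num
  refine ⟨⟨fun _ => R₁, fun _ => ρ, fun _ => recentre (mo 0) s,
    fun i => fun x => Kerr.radius (a i) (poincareInv (recentre (mo 0) s).1 (recentre (mo 0) s).2 x),
    fun _ => shiftTime (B 0) s, U₀, hypBackground U₀, fun _ => Ψ, Ψ₀,
    fun _ => nearLayer (shiftTime (B 0) s) R₁, fun _ => nearUpper (shiftTime (B 0) s) R₁,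
    flatLayer U₀, flatUpper U₀, fun i => rfl, ?_, rfl, fun i => ⟨rfl, rfl⟩, rfl, rfl, ?_, ?_, ?_,
    hΨ₀, hΨ₀e, hΨ₀J, ?_, ?_, Subsingleton.pairwise, ?_, ?_, ?_, ?_, ?_, ?_, ?_, hΨ₀layer,
    Subsingleton.pairwise, hach⟩, ?_⟩
  · -- (2) the recentred background IS the star background of the recentred motion
    intro i
    obtain rfl : i = 0 := Fin.fin_one_eq_zero i
    show shiftTime (B 0) s = _
    rw [hB]
    exact shiftTime_starBackground (mo 0) (M 0) (a 0) s
  · -- (7) labels and radii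
    intro i
    obtain rfl : i = 0 := Fin.fin_one_eq_zero i
    exact ⟨hM, ha, hρ, hρR⟩
  · -- (8) the flat domain contains `{t₀ > −1, r' > ρ}`
    intro x hx
    exact hU₀ ⟨hx.1, hx.2 0⟩
  · -- (9) hole chart: smooth, open embedding, image in `J⁺(ι X)` on the recentred layer
    intro i
    exact ⟨hbox.contMDiffOn_of_subset hL, hbox.isOpenEmbedding_of_subset hL hLo,
      (hbox.image_subset_of_subset hL).trans hC⟩
  · -- (13) slab certification of the hole chart
    intro i
    refine ((supCkENorm_mono_right _ hk _).trans ?_).trans hε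
    exact hbox.supCkENorm_le_of_subset hslab
  · -- (14) slab certification of the flat chart (from the layer certification)
    exact (supCkENorm_mono (image_mono hslab₀) _ _).trans hΨ₀layer
  · -- (16) hole annulus charted by the flat layer
    intro i
    exact hover₁
  · -- (17) flat annulus charted by the hole layer
    intro i
    obtain rfl : i = 0 := Fin.fin_one_eq_zero i
    exact hover₀
  · -- (18) the leaf is sheet ∪ disc
    rw [iUnion_const]
  · -- (19) upper layers in `I⁺(S')`
    rw [iUnion_const]
    exact hW
  · -- (20) barrier clause
    rw [iUnion_const]
    exact hbar
  · -- (S₁) thick honest disc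
    intro i
    obtain rfl : i = 0 := Fin.fin_one_eq_zero i
    exact h2M
  · -- (S₂) near-zone LAYER certification of the hole chart, from the box
    intro i
    refine ((supCkENorm_mono_right _ hk _).trans ?_).trans hε
    exact hbox.supCkENorm_le_of_subset htrunc
  · -- `S' ⊆ J⁺(C)`: the sheet by hypothesis, the disc through the box
    exact union_subset hsheet (hbox.image_subset_of_subset hslab)

/-- **REDUCTION OF K4 TO THE FAR CHART (sorry-free).** The registered stub `stub_farCompletion` follows
from the EXISTENCE OF THE FAR CHART RELATIVE TO THE K3 BOX — the hypothesis `hfar` below, which has the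
stub's quantifier prefix and hypotheses verbatim, promises `ε₁ ≤ ε`, `k ≤ k₁`, and concludes, for every
`(ε₁, k₁)`-box handed over by K3, a recentring time `s`, radii `ρ < R₁` (`2M ≤ R₁ ≤ R`), a flat domain
`U₀` and a hyperboloidal flat chart `Ψ₀` with the far clauses of `isSoundNearKerrLeaf_of_box_of_farChart`
(the card's mechanism: hole chart = the box's late slab, flat chart = an achronal `ε`-flat hyperboloidal
layer through the overlap annulus).  The proof is the assembly theorem plus `J⁺(C) ⊆ J⁺(ι X)`.
STATUS OF `hfar` (report §2–§3): it is NOT available in the tree, and as a uniform statement it is FALSE on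
paper — the box, the collar and the hypothesis leaf are certified in the instance's own Lorentz frame
`(mo 0).1 = Λ`, which is unbounded after `(ε₁, R)` are fixed, and already exact Kerr presented in
coordinates boosted by rapidity `β` admits no far chart matching the given box chart with overlap radius
`ρ < R` once `e^{2β} > ε R / (4M)` (the Kerr–Schild tail is blueshifted to `(4M/r) e^{2β}` in the box's
coordinates, while the overlap clauses (16)–(17) pin the flat coordinates to the hole chart's up to a
translation).  The intended analytic content (semi-global existence and decay relative to Kerr near
`𝓘⁺`, Klainerman–Nicolò-type; Bondi-flux budget of the gap; causal bookkeeping of hyperboloidal sheets)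
is the REST-FRAME, frame-normalised variant F2ʳ of the report, which needs a restatement upstream.
Recorded as the typed form of the mechanism; nothing is asserted. [cite: KlainermanNicolo2003, Thm. 1.1] -/
theorem stub_farCompletion_of_farChart
    (hfar : ∀ (χ m₀ : ℝ) (k : ℕ) (ε : ℝ≥0∞), χ < 1 → 0 < m₀ → 0 < ε →
      ∃ (k₁ : ℕ) (ε₁ : ℝ≥0∞) (R T : ℝ), 0 < ε₁ ∧ ε₁ ≤ ε ∧ k ≤ k₁ ∧ ∃ k' : ℕ, ∀ Λ : ℝ≥0∞, Λ < 1 →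
      ∃ (δ : ℝ≥0∞) (γ : ℝ), 0 < δ ∧ 0 < γ ∧
      ∀ (X : Type) [TopologicalSpace X] [ChartedSpace E3 X] [IsManifold (𝓡 3) ∞ X]
        [T2Space X] [SecondCountableTopology X] [ConnectedSpace X],
      ∀ D ∈ admissibleVacuumData X, ∀ (𝒟 : VacuumCauchyDevelopment D)
        (M a : Fin 1 → ℝ) (S : Set 𝒟.carrier) (p : 𝒟.carrier) (mo : Fin 1 → lorentzGroup × E4)
        (B : Fin 1 → ModelBackground) (Φ : ∀ i, (B i).domain → 𝒟.carrier),
      𝒟.IsMaximal → (∀ i, m₀ ≤ M i ∧ M i ≤ m₀⁻¹ ∧ |a i| ≤ χ * M i) →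
      𝒟.toCauchyDevelopment.IsNearKerrLeaf k' Λ 1 M a S → p ∈ S →
      (∃ i, p ∈ Φ i '' (B i).truncTimeSlab (3 * M i) 0) →
      𝒟.NearKerrCollarCore k' δ γ 1 M a S p mo B Φ →
      ∀ (τ : ℝ) (Ψ : (B 0).domain → 𝒟.carrier),
        IsNearModelBox 𝒟.toSpacetime (B 0) k₁ ε₁ τ (τ + T) (M 0) (R + 1)
          (𝒟.metric.causalFuture 𝒟.timeOrientation (collarCore M p B Φ)) Ψ →
      ∃ (s R₁ ρ : ℝ) (U₀ : Opens E4) (Ψ₀ : (hypBackground U₀).domain → 𝒟.carrier),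
        τ ≤ s - 1 ∧ s + 1 ≤ τ + T ∧ 0 < ρ ∧ ρ < R₁ ∧ 2 * M 0 ≤ R₁ ∧ R₁ ≤ R ∧
        {x : E4 | -1 < x 0 - Real.sqrt (1 + E4.spatialNorm x ^ 2) ∧
          ρ < Kerr.radius (a 0) (poincareInv (recentre (mo 0) s).1 (recentre (mo 0) s).2 x)} ⊆
          (U₀ : Set E4) ∧
        ContMDiffOn 𝓘(ℝ, E4) (𝓡 4) ∞ Ψ₀ (flatLayer U₀) ∧
        IsOpenEmbedding ((flatLayer U₀).restrict Ψ₀) ∧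
        Ψ₀ '' flatLayer U₀ ⊆ 𝒟.metric.causalFuture 𝒟.timeOrientation (range 𝒟.embed) ∧
        supCkENorm (Subtype.val '' flatLayer U₀) k
          (𝒟.toSpacetime.deviationExtend (hypBackground U₀) Ψ₀) ≤ ε ∧
        Ψ '' nearAnnulus (shiftTime (B 0) s) ρ R₁ ⊆ Ψ₀ '' flatLayer U₀ ∧
        Ψ₀ '' flatAnnulus U₀
          (fun x => Kerr.radius (a 0) (poincareInv (recentre (mo 0) s).1 (recentre (mo 0) s).2 x))
          ρ R₁ ⊆ Ψ '' nearLayer (shiftTime (B 0) s) R₁ ∧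
        Ψ₀ '' flatUpper U₀ ∪ Ψ '' nearUpper (shiftTime (B 0) s) R₁ ⊆
          𝒟.metric.chronologicalFuture 𝒟.timeOrientation
            (Ψ₀ '' (hypBackground U₀).timeSlab 0 ∪ Ψ '' (shiftTime (B 0) s).truncTimeSlab R₁ 0) ∧
        𝒟.toCauchyDevelopment.exteriorOf
            (Ψ₀ '' flatUpper U₀ ∪ Ψ '' nearUpper (shiftTime (B 0) s) R₁) \
            (Ψ₀ '' flatUpper U₀ ∪ Ψ '' nearUpper (shiftTime (B 0) s) R₁) ⊆
          𝒟.metric.causalPast 𝒟.timeOrientation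
            (Ψ₀ '' (hypBackground U₀).timeSlab 0 ∪ Ψ '' (shiftTime (B 0) s).truncTimeSlab R₁ 0) ∧
        𝒟.metric.IsAchronal 𝒟.timeOrientation (Ψ₀ '' (hypBackground U₀).timeSlab 0) ∧
        Ψ₀ '' (hypBackground U₀).timeSlab 0 ⊆
          𝒟.metric.causalFuture 𝒟.timeOrientation (collarCore M p B Φ)) :
    ∀ (χ m₀ : ℝ) (k : ℕ) (ε : ℝ≥0∞), χ < 1 → 0 < m₀ → 0 < ε →
    ∃ (k₁ : ℕ) (ε₁ : ℝ≥0∞) (R T : ℝ), 0 < ε₁ ∧ ∃ k' : ℕ, ∀ Λ : ℝ≥0∞, Λ < 1 →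
    ∃ (δ : ℝ≥0∞) (γ : ℝ), 0 < δ ∧ 0 < γ ∧
    ∀ (X : Type) [TopologicalSpace X] [ChartedSpace E3 X] [IsManifold (𝓡 3) ∞ X]
      [T2Space X] [SecondCountableTopology X] [ConnectedSpace X],
    ∀ D ∈ admissibleVacuumData X, ∀ (𝒟 : VacuumCauchyDevelopment D)
      (M a : Fin 1 → ℝ) (S : Set 𝒟.carrier) (p : 𝒟.carrier) (mo : Fin 1 → lorentzGroup × E4)
      (B : Fin 1 → ModelBackground) (Φ : ∀ i, (B i).domain → 𝒟.carrier),
    𝒟.IsMaximal → (∀ i, m₀ ≤ M i ∧ M i ≤ m₀⁻¹ ∧ |a i| ≤ χ * M i) →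
    𝒟.toCauchyDevelopment.IsNearKerrLeaf k' Λ 1 M a S → p ∈ S →
    (∃ i, p ∈ Φ i '' (B i).truncTimeSlab (3 * M i) 0) →
    𝒟.NearKerrCollarCore k' δ γ 1 M a S p mo B Φ →
    (∃ (τ : ℝ) (Ψ : (B 0).domain → 𝒟.carrier),
      IsNearModelBox 𝒟.toSpacetime (B 0) k₁ ε₁ τ (τ + T) (M 0) (R + 1)
        (𝒟.metric.causalFuture 𝒟.timeOrientation (collarCore M p B Φ)) Ψ) →
    ∃ S' : Set 𝒟.carrier, 𝒟.toCauchyDevelopment.IsSoundNearKerrLeaf k ε 1 M a S' ∧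
      S' ⊆ 𝒟.metric.causalFuture 𝒟.timeOrientation (collarCore M p B Φ) := by
  intro χ m₀ k ε hχ hm₀ hε
  obtain ⟨k₁, ε₁, R, T, hε₁, hε₁ε, hkk₁, k', hfar'⟩ := hfar χ m₀ k ε hχ hm₀ hε
  refine ⟨k₁, ε₁, R, T, hε₁, k', fun Λ hΛ => ?_⟩
  obtain ⟨δ, γ, hδ, hγ, H⟩ := hfar' Λ hΛ
  refine ⟨δ, γ, hδ, hγ, ?_⟩
  intro X _ _ _ _ _ _ D hD 𝒟 M a S p mo B Φ hmax hwin hleaf hp hpc hcore hbox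
  obtain ⟨τ, Ψ, hbox⟩ := hbox
  obtain ⟨s, R₁, ρ, U₀, Ψ₀, hs₁, hs₂, hρ, hρR, h2M, hR₁, hU₀, hΨ₀, hΨ₀e, hΨ₀J, hΨ₀layer, hover₁,
    hover₀, hW, hbar, hach, hsheet⟩ :=
    H X D hD 𝒟 M a S p mo B Φ hmax hwin hleaf hp hpc hcore τ Ψ hbox
  -- labels: `0 < M`, `|a| ≤ χ M ≤ M`
  have hM : 0 < M 0 := hm₀.trans_le (hwin 0).1
  have ha : |a 0| ≤ M 0 := (hwin 0).2.2.trans (by nlinarith [hM])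
  exact ⟨_, isSoundNearKerrLeaf_of_box_of_farChart 𝒟 hM ha (hcore.background_eq 0)
    (causalFuture_collarCore_subset hleaf hp hcore.image_subset) hbox hkk₁ hε₁ε hs₁ hs₂ hρ hρR h2M
    hR₁ hU₀ hΨ₀ hΨ₀e hΨ₀J hΨ₀layer hover₁ hover₀ hW hbar hach hsheet⟩

end Assembly

end FarCompletionBookkeeping

/-- **K4 — FAR COMPLETION** (shared far-field engine: `core-cone-calibration` K4,
`hyperboloidal-mass-pinches-flat` F3/B2 far zone; here in BOX form).  For every margin/window and target
`(k, ε)` the far engine names the box it needs — quality `(k₁, ε₁)`, radius `R` (≳ `M/ε`, so that Kerr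
is `ε`-flat beyond the overlap annulus) and LENGTH `T` (≳ the light-crossing time of the radiation
zone it certifies, so that the near zone is quiet over the retarded times the sheet sees) — and a `k'`;
then below the honesty threshold some `δ, γ > 0` make the following true in every MGHD of admissible
data: a `(Λ, k')`-leaf `S ∋ p` through ONE `δ`-Kerr thick collar containing `p`, core with a cut energy
and gap `≤ γ`, PLUS an `(ε₁, k₁)`-Kerr box `{τ < t* < τ + T, M < r < R + 1}` inside `J⁺(C)`, yield a
SOUND `(ε, k)`-near-Kerr leaf with the same `(M, a)` inside `J⁺(C)` (hole chart = the box's late slab,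
thick and layer-certified; flat chart = an achronal `ε`-flat hyperboloidal LAYER through the overlap
annulus out to `𝓘⁺`).  Mechanism: beyond `R` the metric is Kerr's tail `O(M/r)` plus radiation;
outgoing radiation crossing the sheet was emitted by the near zone during the box's time span
(`ε₁`-small with `k₁ − k` derivatives to spare), incoming radiation beyond `R` is bounded in flux by the
gap budget (`∫_{N ∩ {r > R}} Φ_H ≤ γ + Cδ + Cε₁ + O(M³a²/R³)`) and in `C^k` by the hypothesis leaf's
`C^{k'}` bound where it crossed `S` together with the `o₂` fall-off of admissible data (multiplicative
derivative loss, `k' ≈ 3k`, dossier a1); Gagliardo–Nirenberg cell by cell gives unweighted Cartesian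
`C^k`-flatness of the layer, and the sheet is achronal by construction (spacelike graph).  Why it might
fail: uniformly-local control of a `Λ ~ 1` (large) development along the outgoing direction up to `𝓘⁺`
is not a small-data statement — the honest content is semi-global Cauchy-characteristic existence
relative to Kerr near `𝓘⁺` with small CHARACTERISTIC data but large interior (Klainerman–Nicolò-type,
Kerr version unavailable), and HF incoming trains invisible to the gap must be excluded by the leaf
bound + decay class (barrier `NullConditionFailure` evasion (i)).  Size: XL.  Sources: KlainermanNicolo2003,
arXiv:1107.0898, DafermosHolzegelRodnianskiTaylor2021, arXiv:1406.3009, ChristodoulouKlainerman1993PMS41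
Ch. 17, DeviationTolerance.lean / SoundNearKerrLeaf.lean (why `Λ < 1`, why sound). -/
theorem stub_farCompletion : ∀ (χ m₀ : ℝ) (k : ℕ) (ε : ℝ≥0∞), χ < 1 → 0 < m₀ → 0 < ε →
    ∃ (k₁ : ℕ) (ε₁ : ℝ≥0∞) (R T : ℝ), 0 < ε₁ ∧ ∃ k' : ℕ, ∀ Λ : ℝ≥0∞, Λ < 1 →
    ∃ (δ : ℝ≥0∞) (γ : ℝ), 0 < δ ∧ 0 < γ ∧
    ∀ (X : Type) [TopologicalSpace X] [ChartedSpace E3 X] [IsManifold (𝓡 3) ∞ X]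
      [T2Space X] [SecondCountableTopology X] [ConnectedSpace X],
    ∀ D ∈ admissibleVacuumData X, ∀ (𝒟 : VacuumCauchyDevelopment D)
      (M a : Fin 1 → ℝ) (S : Set 𝒟.carrier) (p : 𝒟.carrier) (mo : Fin 1 → lorentzGroup × E4)
      (B : Fin 1 → ModelBackground) (Φ : ∀ i, (B i).domain → 𝒟.carrier),
    𝒟.IsMaximal → (∀ i, m₀ ≤ M i ∧ M i ≤ m₀⁻¹ ∧ |a i| ≤ χ * M i) →
    𝒟.toCauchyDevelopment.IsNearKerrLeaf k' Λ 1 M a S → p ∈ S →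
    (∃ i, p ∈ Φ i '' (B i).truncTimeSlab (3 * M i) 0) →
    𝒟.NearKerrCollarCore k' δ γ 1 M a S p mo B Φ →
    (∃ (τ : ℝ) (Ψ : (B 0).domain → 𝒟.carrier),
      IsNearModelBox 𝒟.toSpacetime (B 0) k₁ ε₁ τ (τ + T) (M 0) (R + 1)
        (𝒟.metric.causalFuture 𝒟.timeOrientation (collarCore M p B Φ)) Ψ) →
    ∃ S' : Set 𝒟.carrier, 𝒟.toCauchyDevelopment.IsSoundNearKerrLeaf k ε 1 M a S' ∧
      S' ⊆ 𝒟.metric.causalFuture 𝒟.timeOrientation (collarCore M p B Φ) := by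
  sorry

end Summit.FinalStateConjecture.FinalStateConjecture.Theorems.BondiBartnikRigidity.DirectMethod

end
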